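import Summits.QuantumFields.BalabanUV.Beta.MultiscaleGradientCovariantLocal

/-!
# `Summit.QuantumFields.BalabanUV.Beta.MultiscaleGradientCovariantCases` — THE TWO CASES OF THE LOCAL INEQUALITY OF THE COVARIANT
# GRADIENT MEMBER FOR `levelOp` (file A2 of the levelOp twin of the owner's 19b under road P3's reduction «rough-`Rm` gradient member ⇐
# flat interior estimate (FG) + sup member + ONE (3.35)-shaped binder (SF)», claim «COVARIANT-FLAT-SPLIT»)

HONEST FRAMING (page 1 of everything in this cell).  Discharging `FlowStep.BetaPertH` would make Bałaban's ultraviolet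
stability UNCONDITIONAL — a constructive-QFT result; it is NOT the continuum limit and NOT the Clay problem.  This module
discharges nothing of `BetaPertH`; it is [folklore] finite-dimensional bookkeeping about the MODEL operator, kernel-checked, by CO-OWNER #3
of binder row D4 (unit `b2b-balaban-beta-d4-p3`, road P3 «reduction road», gen 13), in the OWNER's file-19b setting and letters
(`MultiscaleGradientMember`, an4-g46).  HONEST DEPENDENCY: continuum YM on T⁴ ⇐ BetaPertH ∧ nine spine estimates (0/9 proved);
BetaPertH ⇐ (D1) ∧ (D4) ∧ CAP+tail; G-an2-4 gates asym, D1 and NE2/3/4.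

THE POINT.  In 19b's EXACT section setting minus `hflat` (any column-orthonormal `Rm`), for `f = (levelOp)⁻¹u` (`u` supported in cell `k′`,
`|u| ≤ m`) and a bond `(x, μ)`:
* **`covariant_grad_local_good`** — GOOD CASE (`R₀ ≥ 1`, `10R₀ + 4 ≤ N_j`, `R₀ ≤ n(x)θ/4 < R₀ + 1`), modulo (FG) ∧ (SF) (HYPOTHESES), for a
  bound `Y` of `‖D_R f‖` on the bonds starting in `{dist(·,x) ≤ 2R₀+3}`:
  `‖(D_R f)((x,μ),·)‖ ≤ |c₀|√|Cp|·[√|Cp|K₁𝔅Γ²e^δ·16dΓ + √|Cp|K₂(θ/4+1)(e^{δ(2d+1)} + a_max√|Cp|𝔅e^{δ(4d+1)})/c₀² + √|Cp|K₂d(σ₂+σ₁²)𝔅Γ²e^δ·16dΓ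
   + σ₁𝔅Γ²e^δ·16dΓ]·n(x)e^{−δD}m + (2dK₂σ₁√|Cp|)·Y` — file A1's core with `M = 𝔅Γ²e^δn(x)²e^{−δD}m` from the CLOSED sup member (file 17 via
  19a `abs_le_on_unit_ball`) and `G = √|Cp|(e^{δ(2d+1)} + a_max√|Cp|𝔅e^{δ(4d+1)})e^{−δD}m` from `D_R*D_R f = u − Σ_l a_lG_lᵀG_l f` (ANY `Rm`) +
  19a `abs_levelSum_le_on_unit_ball`;
* **`covariant_grad_local_small`** — SMALL CASE (`n(x) ≤ 16dΓ`): `‖(D_R f)((x,μ),·)‖ ≤ |c₀|√|Cp|·𝔅(Γ²e^δ + 1)·16dΓ·n(x)e^{−δD}m` (the trivial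
  bound `|c₀|(‖f(x+e_μ)‖ + ‖f(x)‖)` against the sup member).
File A3 (`MultiscaleGradientCovariantStep`) joins the two cases; file B runs the bootstrap.  WHAT THIS IS NOT: not a bound on Bałaban's
∇_UG′(U); (FG), (SF) are hypothesis SHAPES ((3.35) p. 396 a LOCATOR, not asserted); row D4 readiness width 0; D4 DISCHARGE NO DATE.
LOCATORS (shape only; ABSOLUTE RULE): [Balaban1985BackgroundPropagators] (3.35) p. 396, Thm 3.1 (3.42) p. 397; [Balaban1983RegularityDecay]
Lemma 2.2 (2.17) pp. 577–578.  NOT BetaPertH, NOT continuum, NOT Clay, NOT summit progress.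
-/

open scoped BigOperators
open Finset

namespace Summit.QuantumFields.BalabanUV.Beta.MultiscaleGradientCovariantCases

open Summit.QuantumFields.BalabanUV.Beta.BoxPoincare (Box)
open Summit.QuantumFields.BalabanUV.Beta.MultiscaleCoerciveTorus
open Summit.QuantumFields.BalabanUV.Beta.MultiscaleDistance
open Summit.QuantumFields.BalabanUV.Beta.MultiscaleDistanceMetric (sdist_comm sdist_triangle_torus)
open Summit.QuantumFields.BalabanUV.Beta.MultiscaleDecayBudget
open Summit.QuantumFields.BalabanUV.Beta.MultiscaleDecay (decay_levelOp)
open Summit.QuantumFields.BalabanUV.Beta.AccretiveCombesThomasSandwichSite (sdist_corner_thresholds)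
open Summit.QuantumFields.BalabanUV.Beta.MultiscaleBoxDistance (sdist_le_of_dist_le)
open Summit.QuantumFields.BalabanUV.Beta.MultiscaleRegularityClosed (real_sup_levelOp_inverse_le)
open Summit.QuantumFields.BalabanUV.Beta.MultiscaleGradientSource (abs_le_on_unit_ball abs_levelSum_le_on_unit_ball)
open Summit.QuantumFields.BalabanUV.Beta.SubsolutionMeanValueBox (Cmv Cmv_pos)
open Summit.QuantumFields.BalabanUV.Beta.CovariantKato (sqrt_sum_sq_add_le sqrt_sum_sq_smul sqrt_sum_sq_Rm)
open Summit.QuantumFields.BalabanUV.Beta.CovariantGradientBox (norm_le_sqrt_card_of_abs_le covariant_fdiff_le_box)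
open Literature.MathematicalPhysics.QuantumFieldTheory.Balaban1983to89
open Literature.MathematicalPhysics.QuantumFieldTheory.Balaban1983to89.B9Thm37Glue (covD covDT covD_apply covDT_apply)
open Literature.MathematicalPhysics.QuantumFieldTheory.Balaban1983to89.B9Thm37GluePU (bsrc btgt bsrc_apply btgt_apply)
open Literature.MathematicalPhysics.QuantumFieldTheory.Balaban1983to89.B9Thm37GlueTorusCov (tblk)
open Literature.MathematicalPhysics.QuantumFieldTheory.Balaban1983to89.B9Thm37GlueTorusCovLevels (levelOp levelSum)
open B5TorusCover (UT Ctr ctrU)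
open B5Leibniz121 (up dn)

open Summit.QuantumFields.BalabanUV.Beta.MultiscaleGradientCovariantLocal (norm_covD_le_trivial covariant_grad_core)

noncomputable section

variable {d : ℕ} {N : Fin d → ℕ} [∀ i, NeZero (N i)]

section Main


variable [NeZero d] {Cp J K : Type} [Fintype Cp] [DecidableEq Cp] [Nonempty Cp]
  [Fintype J] [Fintype K] [DecidableEq K] (S : J → ℕ) (hS : ∀ l, 1 ≤ S l) (hdivS : ∀ l i, S l ∣ N i) (lvl : K → J)
  (zc : (k : K) → Ctr N (S (lvl k)))
  (hdisj : ∀ k k' v v', cellPt S hS hdivS lvl zc k v = cellPt S hS hdivS lvl zc k' v' → k = k')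
  (hcover : ∀ x : UT N, ∃ k, ∃ v : Box d (S (lvl k)), cellPt S hS hdivS lvl zc k v = x)
  (Rm : UT N × Fin d → Cp → Cp → ℝ) (hRm : ∀ b i j, ∑ k, Rm b k i * Rm b k j = if i = j then (1 : ℝ) else 0)
  (T : J → UT N → Cp → Cp → ℝ) (hT : ∀ l x i i', ∑ k, T l x k i * T l x k i' = if i = i' then (1 : ℝ) else 0)
  (a : J → ℝ) (ha : ∀ j, 0 ≤ a j) (ω : J → UT N → ℝ)
  (hsupp : ∀ l x, ω l (ctrU N (S l) (tblk (hS l) (hdivS l) x)) ≠ 0 → ∃ k v, lvl k = l ∧ cellPt S hS hdivS lvl zc k v = x)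
  {amax : ℝ} (hamax : 0 ≤ amax)
  (hscale : ∀ k, a (lvl k) * ω (lvl k) (ctrU N (S (lvl k)) (zc k)) ^ 2 * (S (lvl k) : ℝ) ^ d ≤ amax / (S (lvl k) : ℝ) ^ 2)
  (c : UT N × Fin d → ℝ) {c₀ : ℝ} (hcc : ∀ b, c b = c₀) (hc₀ : c₀ ≠ 0)
  {L : ℕ} (hL : 1 ≤ L) (e : J → ℕ) (hSe : ∀ l, S l = L ^ e l) {R : ℝ} (hR : 0 < R) {A : ℕ}
  (hadd : ∀ x y : UT N, |(e (lvl (cellOf S hS hdivS lvl zc hcover x)) : ℝ) - e (lvl (cellOf S hS hdivS lvl zc hcover y))| ≤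
    A + sdist bsrc btgt (siteScale S hS hdivS lvl zc hcover) x y / R)

include hdisj hT ha hsupp hamax hscale hL e hSe hR hadd hRm hcc hc₀

/-- **THE LOCAL INEQUALITY, GOOD CASE** (`R₀ ≥ 1`, room `10R₀ + 4 ≤ N_j`, `R₀ ≤ n(x)θ/4 < R₀ + 1`): for `f = (levelOp)⁻¹u` and a bound `Y`
of `‖D_R f‖` on the bonds starting in `{dist(·,x) ≤ 2R₀+3}`,
`‖(D_R f)((x,μ),·)‖ ≤ |c₀|√|Cp|·(T_cov − T₁)·n(x)e^{−δD}m + (2dK₂σ₁√|Cp|)·Y` (§2's core with `M`, `G` from the CLOSED sup member, the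
source and 19a's unit-ball reading of the averaging part; (FG), (SF) HYPOTHESES). [folklore] -/
theorem covariant_grad_local_good {cmax : ℝ} (hc : ∀ b, |c b| ≤ cmax) {C : ℝ}
    (hcoer : ∀ f : UT N × Cp → ℝ,
      C * ∑ k, ((S (lvl k) : ℝ) ^ 2)⁻¹ * ∑ v : Box d (S (lvl k)), ∑ i, f (cellPt S hS hdivS lvl zc k v, i) ^ 2 ≤
        ∑ p, f p * levelOp bsrc btgt c Rm (fun l x => ctrU N (S l) (tblk (hS l) (hdivS l) x))
          (fun l x => ω l (ctrU N (S l) (tblk (hS l) (hdivS l) x))) T a f p)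
    {κ : ℝ} (hκ0 : 0 ≤ κ) (hκ1 : κ ≤ 1) (hμ : 0 < C - 2 * d * cmax ^ 2 * κ ^ 2 - amax * (Real.exp (2 * d * κ) - 1))
    (hrate : (1 + d / 2) * (Real.log L / R) ≤ κ)
    {Γ θ δ 𝔅 : ℝ} (hΓ : Γ = (L : ℝ) ^ A * Real.exp (Real.log L / R * (4 * d + 1))) (hθ : θ = 1 / (4 * d * Γ))
    (hδ : δ = κ - (1 + d / 2) * (Real.log L / R))
    (h𝔅 : 𝔅 = (max (Real.sqrt (11 ^ d)) (Cmv d * Real.sqrt (21 ^ d)) / Real.sqrt (θ ^ d) +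
            Real.sqrt (Fintype.card Cp) * (θ + 1) ^ 2 * (amax * Γ ^ 2 * Real.sqrt (Γ ^ d)) / (2 * c₀ ^ 2)) *
          (Real.sqrt (Fintype.card Cp) * Real.exp (κ * ((4 * d + 1) + 2 * d)) *
            ((L : ℝ) ^ A * Real.exp (Real.log L / R * (4 * d + 1))) * (L : ℝ) ^ A * Real.sqrt (((L : ℝ) ^ A) ^ d) /
            (C - 2 * d * cmax ^ 2 * κ ^ 2 - amax * (Real.exp (2 * d * κ) - 1))) +
          Real.sqrt (Fintype.card Cp) * (θ + 1) ^ 2 / (2 * c₀ ^ 2) *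
            Real.exp ((κ - (1 + d / 2) * (Real.log L / R)) * ((4 * d + 1) + 2 * d)))
    {K₁ K₂ : ℝ} (hK₁ : 0 ≤ K₁) (hK₂ : 0 ≤ K₂)
    (hFG : ∀ (x₀ : UT N) (R : ℕ), 1 ≤ R → (∀ i, 10 * R + 4 ≤ N i) → ∀ (w : UT N → ℝ) (M G : ℝ),
      (∀ x ∈ univ.filter (fun x : UT N => dist x x₀ ≤ 2 * R + 2), |w x| ≤ M) →
      (∀ x ∈ univ.filter (fun x : UT N => dist x x₀ ≤ 2 * R + 2),
        |((∑ b ∈ univ.filter (fun b : UT N × Fin d => btgt b = x), c b ^ 2) +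
              ∑ b ∈ univ.filter (fun b : UT N × Fin d => bsrc b = x), c b ^ 2) * w x -
            ((∑ b ∈ univ.filter (fun b : UT N × Fin d => btgt b = x), c b ^ 2 * w (bsrc b)) +
              ∑ b ∈ univ.filter (fun b : UT N × Fin d => bsrc b = x), c b ^ 2 * w (btgt b))| ≤ G) →
      ∀ μ, |w (up x₀ μ) - w x₀| ≤ K₁ * M / ((R : ℝ) + 1) + K₂ * ((R : ℝ) + 1) * G / c₀ ^ 2)
    {σ₁ σ₂ : ℝ} (hσ₁ : 0 ≤ σ₁) (hσ₂ : 0 ≤ σ₂)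
    (hSF : ∀ (x₀ : UT N) (R : ℕ), 1 ≤ R → (R : ℝ) ≤ (siteScale S hS hdivS lvl zc hcover x₀ : ℝ) * θ / 4 →
      (siteScale S hS hdivS lvl zc hcover x₀ : ℝ) * θ / 4 < R + 1 → ∃ g : UT N → Cp → Cp → ℝ, ∃ Rg : UT N × Fin d → Cp → Cp → ℝ,
      (∀ x i j, ∑ k, g x k i * g x k j = if i = j then (1 : ℝ) else 0) ∧
      (∀ b i j, Rg b i j = ∑ k, g (bsrc b) i k * ∑ l, Rm b k l * g (btgt b) j l) ∧
      (∀ b : UT N × Fin d, dist (bsrc b) x₀ ≤ 2 * R + 3 → ∀ v : Cp → ℝ,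
        Real.sqrt (∑ i, (∑ j, (Rg b i j - if i = j then (1 : ℝ) else 0) * v j) ^ 2) ≤
          σ₁ / ((R : ℝ) + 1) * Real.sqrt (∑ j, v j ^ 2)) ∧
      (∀ x ∈ univ.filter (fun x : UT N => dist x x₀ ≤ 2 * R + 2), ∀ μ (v : Cp → ℝ),
        Real.sqrt (∑ i, (∑ j, (Rg (dn x μ, μ) i j - Rg (x, μ) i j) * v j) ^ 2) ≤
          σ₂ / ((R : ℝ) + 1) ^ 2 * Real.sqrt (∑ j, v j ^ 2)))
    (k' : K) (u : UT N × Cp → ℝ) (hu : ∀ p, cellOf S hS hdivS lvl zc hcover p.1 ≠ k' → u p = 0)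
    {m : ℝ} (hm : 0 ≤ m) (hum : ∀ p, |u p| ≤ m) (f : UT N × Cp → ℝ)
    (hf : f = (Ring.inverse (levelOp bsrc btgt c Rm (fun l x => ctrU N (S l) (tblk (hS l) (hdivS l) x))
        (fun l x => ω l (ctrU N (S l) (tblk (hS l) (hdivS l) x))) T a)) u)
    (x : UT N) (μ : Fin d)
    {R₀ : ℕ} (hR1 : 1 ≤ R₀) (hroom : ∀ j, 10 * R₀ + 4 ≤ N j)
    (hR₀le : (R₀ : ℝ) ≤ (siteScale S hS hdivS lvl zc hcover x : ℝ) * θ / 4)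
    (hR₀lt : (siteScale S hS hdivS lvl zc hcover x : ℝ) * θ / 4 < R₀ + 1) {Y : ℝ} (hY0 : 0 ≤ Y)
    (hY : ∀ b : UT N × Fin d, dist (bsrc b) x ≤ 2 * R₀ + 3 → Real.sqrt (∑ i, covD bsrc btgt c Rm f (b, i) ^ 2) ≤ Y) :
    Real.sqrt (∑ i, covD bsrc btgt c Rm f ((x, μ), i) ^ 2) ≤
      |c₀| * Real.sqrt (Fintype.card Cp) *
          (Real.sqrt (Fintype.card Cp) * K₁ * 𝔅 * Γ ^ 2 * Real.exp δ * (16 * d * Γ) +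
            Real.sqrt (Fintype.card Cp) * K₂ * (θ / 4 + 1) *
              (Real.exp (δ * (2 * d + 1)) + amax * Real.sqrt (Fintype.card Cp) * 𝔅 * Real.exp (δ * (4 * d + 1))) / c₀ ^ 2 +
            Real.sqrt (Fintype.card Cp) * K₂ * (d * (σ₂ + σ₁ ^ 2)) * 𝔅 * Γ ^ 2 * Real.exp δ * (16 * d * Γ) +
            σ₁ * 𝔅 * Γ ^ 2 * Real.exp δ * (16 * d * Γ)) *
        (siteScale S hS hdivS lvl zc hcover x : ℝ) *
        Real.exp (-(δ * sdist bsrc btgt (siteScale S hS hdivS lvl zc hcover) x (ctrU N (S (lvl k')) (zc k')))) * m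
      + 2 * d * K₂ * σ₁ * Real.sqrt (Fintype.card Cp) * Y := by
  classical
  -- abbreviations
  set Aop := levelOp bsrc btgt c Rm (fun l x => ctrU N (S l) (tblk (hS l) (hdivS l) x))
    (fun l x => ω l (ctrU N (S l) (tblk (hS l) (hdivS l) x))) T a with hAop
  set Pop := levelSum (fun l x => ctrU N (S l) (tblk (hS l) (hdivS l) x))
    (fun l x => ω l (ctrU N (S l) (tblk (hS l) (hdivS l) x))) T a with hPop
  set n := siteScale S hS hdivS lvl zc hcover with hn
  set tk' : UT N := ctrU N (S (lvl k')) (zc k') with htk'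
  set D : ℝ := sdist bsrc btgt n x tk' with hD
  generalize hKc : Real.sqrt (Fintype.card Cp) = Kc
  obtain ⟨i₀⟩ := ‹Nonempty Cp›
  -- positivity
  have hd1 : (1 : ℝ) ≤ d := by exact_mod_cast Nat.one_le_iff_ne_zero.mpr (NeZero.ne d)
  have hd0 : (0 : ℝ) < d := by linarith
  have hL1 : (1 : ℝ) ≤ L := by exact_mod_cast hL
  have ht0 : 0 ≤ Real.log L / R := div_nonneg (Real.log_nonneg hL1) hR.le
  have hΓ1 : 1 ≤ Γ := by
    rw [hΓ]
    exact one_le_mul_of_one_le_of_one_le (one_le_pow₀ hL1) (Real.one_le_exp (mul_nonneg ht0 (by positivity)))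
  have hΓ0 : 0 < Γ := by linarith
  have hθ0 : 0 < θ := by rw [hθ]; positivity
  have hδ0 : 0 ≤ δ := by rw [hδ]; linarith
  have hc2 : (0 : ℝ) < c₀ ^ 2 := by positivity
  have hKc0 : 0 ≤ Kc := by rw [← hKc]; exact Real.sqrt_nonneg _
  have h𝔅0 : 0 ≤ 𝔅 := by rw [h𝔅]; positivity
  have hnpos : ∀ y, (0 : ℝ) < (n y : ℝ) := fun y => by exact_mod_cast one_le_siteScale S hS hdivS lvl zc hcover y
  -- THE CLOSED SUP MEMBER (file 17) at every site-component
  have hsup : ∀ q : UT N × Cp, |f q| ≤ 𝔅 * (n q.1 : ℝ) ^ 2 * Real.exp (-(δ * sdist bsrc btgt n q.1 tk')) * m := by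
    intro q
    have h := real_sup_levelOp_inverse_le S hS hdivS lvl zc hdisj hcover Rm hRm T hT a ha ω hsupp hamax hscale c hcc hc₀ hL e
      hSe hR hadd hc hcoer hκ0 hκ1 hμ hrate hΓ hθ k' u hu hm hum q
    rw [← h𝔅, ← hδ, ← hf] at h
    exact h
  -- (α) on the `d_n`-ball of radius 1 around `x`
  set M := 𝔅 * Γ ^ 2 * Real.exp δ * (n x : ℝ) ^ 2 * Real.exp (-(δ * D)) * m with hM
  have hM0 : 0 ≤ M := by rw [hM]; positivity
  have hαF : ∀ y : UT N, sdist bsrc btgt n y x ≤ 1 → Real.sqrt (∑ j, f (y, j) ^ 2) ≤ Kc * M := fun y hy => by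
    rw [← hKc]
    exact norm_le_sqrt_card_of_abs_le (fun j => f (y, j)) hM0
      (fun j => abs_le_on_unit_ball S hS hdivS lvl zc hcover hL e hSe hR hadd hΓ hδ0 h𝔅0 hm f tk' hsup hy j)
  set E := (n x : ℝ) * Real.exp (-(δ * D)) * m with hE
  have hE0 : 0 ≤ E := by rw [hE]; positivity
  have hunit : IsUnit Aop :=
    (decay_levelOp S hS hdivS lvl zc hdisj hcover Rm hRm T hT a ha ω hsupp hamax hscale c hc hcoer hκ0 hκ1 hμ
      (tk', i₀) (tk', i₀)).1
  have hAf : Aop f = u := by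
    rw [hf, ← Module.End.mul_apply, Ring.mul_inverse_cancel _ hunit, Module.End.one_apply]
  -- (β) `D_R*D_R f = u − Pop f` (ANY transports), bounded on the ball by `Ub + Pb`; fibre form
  set Pb := amax * Kc * 𝔅 * Real.exp (δ * (4 * d + 1)) * Real.exp (-(δ * D)) * m with hPb
  set Ub := Real.exp (δ * (2 * d + 1)) * Real.exp (-(δ * D)) * m with hUb
  have hUP0 : 0 ≤ Ub + Pb := by rw [hUb, hPb]; positivity
  have hthr := sdist_corner_thresholds S hS hdivS lvl zc hdisj hcover
  have hβ : ∀ (y : UT N) (j : Cp), sdist bsrc btgt n y x ≤ 1 → |covDT bsrc btgt c Rm (covD bsrc btgt c Rm f) (y, j)| ≤ Ub + Pb := by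
    intro y j hy
    have hsplit : covDT bsrc btgt c Rm (covD bsrc btgt c Rm f) (y, j) = u (y, j) - Pop f (y, j) := by
      have : Aop f (y, j) = covDT bsrc btgt c Rm (covD bsrc btgt c Rm f) (y, j) + Pop f (y, j) := by
        rw [hAop, hPop, levelOp, LinearMap.add_apply, LinearMap.comp_apply, Pi.add_apply]
      rw [hAf] at this
      linarith
    have hu_le : |u (y, j)| ≤ Ub := by
      by_cases hky : cellOf S hS hdivS lvl zc hcover y = k'
      · have h2d : sdist bsrc btgt n y tk' ≤ 2 * d := (hthr y k').1 hky
        have htri : D ≤ sdist bsrc btgt n x y + sdist bsrc btgt n y tk' := sdist_triangle_torus n x y tk'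
        have hsym : sdist bsrc btgt n x y = sdist bsrc btgt n y x := sdist_comm bsrc btgt n x y
        have hexp : (1 : ℝ) ≤ Real.exp (δ * (2 * d + 1)) * Real.exp (-(δ * D)) := by
          rw [← Real.exp_add]
          refine Real.one_le_exp ?_
          have : δ * D ≤ δ * (2 * d + 1) := mul_le_mul_of_nonneg_left (by linarith) hδ0
          linarith
        calc |u (y, j)| ≤ m := hum (y, j)
          _ = 1 * m := (one_mul m).symm
          _ ≤ Ub := by rw [hUb]; exact mul_le_mul_of_nonneg_right hexp hm
      · rw [hu (y, j) hky, abs_zero]; rw [hUb]; positivity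
    have hP_le : |Pop f (y, j)| ≤ Pb := by
      have h := abs_levelSum_le_on_unit_ball S hS hdivS lvl zc hdisj hcover T hT a ha ω hsupp hamax hscale hδ0 h𝔅0 hm f tk' hsup hy j
      rw [hKc] at h
      rw [hPb]; exact h
    rw [hsplit]
    exact (abs_sub _ _).trans (add_le_add hu_le hP_le)
  have hβF : ∀ y : UT N, sdist bsrc btgt n y x ≤ 1 →
      Real.sqrt (∑ j, covDT bsrc btgt c Rm (covD bsrc btgt c Rm f) (y, j) ^ 2) ≤ Kc * (Ub + Pb) := fun y hy => by
    rw [← hKc]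
    exact norm_le_sqrt_card_of_abs_le (fun j => covDT bsrc btgt c Rm (covD bsrc btgt c Rm f) (y, j)) hUP0 (fun j => hβ y j hy)
  -- §2's core
  have hαF' : ∀ y : UT N, sdist bsrc btgt n y x ≤ 1 → Real.sqrt (∑ j, f (y, j) ^ 2) ≤ Real.sqrt (Fintype.card Cp) * M := by
    rw [hKc]; exact hαF
  have hcore := covariant_grad_core S hS hdivS lvl zc hcover Rm hRm c hcc hc₀ hL e hSe hR hadd hΓ hθ hK₁ hK₂ hFG hσ₁ hσ₂ hSF
    f x μ hR1 hroom hR₀le hR₀lt hM0 (mul_nonneg hKc0 hUP0) hY0 hαF' hβF hY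
  rw [hKc] at hcore
  have hMx : M * (16 * d * Γ) / n x = 𝔅 * Γ ^ 2 * Real.exp δ * (16 * d * Γ) * E := by
    rw [hM, hE, div_eq_iff (hnpos x).ne']
    ring
  have hGx : (n x : ℝ) * (Kc * (Ub + Pb)) =
      Kc * (Real.exp (δ * (2 * d + 1)) + amax * Kc * 𝔅 * Real.exp (δ * (4 * d + 1))) * E := by
    rw [hUb, hPb, hE]; ring
  have hid : |c₀| * Kc * ((Kc * K₁ + Kc * K₂ * (d * (σ₂ + σ₁ ^ 2)) + σ₁) * (M * (16 * d * Γ) / n x) +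
      K₂ * (θ / 4 + 1) * n x * (Kc * (Ub + Pb)) / c₀ ^ 2) =
      |c₀| * Kc * (Kc * K₁ * 𝔅 * Γ ^ 2 * Real.exp δ * (16 * d * Γ) +
        Kc * K₂ * (θ / 4 + 1) * (Real.exp (δ * (2 * d + 1)) + amax * Kc * 𝔅 * Real.exp (δ * (4 * d + 1))) / c₀ ^ 2 +
        Kc * K₂ * (d * (σ₂ + σ₁ ^ 2)) * 𝔅 * Γ ^ 2 * Real.exp δ * (16 * d * Γ) + σ₁ * 𝔅 * Γ ^ 2 * Real.exp δ * (16 * d * Γ)) * E := by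
    rw [hMx, show K₂ * (θ / 4 + 1) * (n x : ℝ) * (Kc * (Ub + Pb)) = K₂ * (θ / 4 + 1) * ((n x : ℝ) * (Kc * (Ub + Pb))) by ring,
      hGx]
    field_simp
    ring
  rw [hid] at hcore
  rw [hE] at hcore
  calc Real.sqrt (∑ i, covD bsrc btgt c Rm f ((x, μ), i) ^ 2) ≤ _ := hcore
    _ = _ := by ring

/-- **THE LOCAL INEQUALITY, SMALL CASE** (`n(x) ≤ 16dΓ`): the trivial bound `‖(D_R f)((x,μ),·)‖ ≤ |c₀|(‖f(x+e_μ)‖ + ‖f(x)‖)` read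
against the CLOSED sup member gives `≤ |c₀|√|Cp|·𝔅(Γ²e^δ + 1)·16dΓ·n(x)e^{−δD}m`. [folklore] -/
theorem covariant_grad_local_small {cmax : ℝ} (hc : ∀ b, |c b| ≤ cmax) {C : ℝ}
    (hcoer : ∀ f : UT N × Cp → ℝ,
      C * ∑ k, ((S (lvl k) : ℝ) ^ 2)⁻¹ * ∑ v : Box d (S (lvl k)), ∑ i, f (cellPt S hS hdivS lvl zc k v, i) ^ 2 ≤
        ∑ p, f p * levelOp bsrc btgt c Rm (fun l x => ctrU N (S l) (tblk (hS l) (hdivS l) x))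
          (fun l x => ω l (ctrU N (S l) (tblk (hS l) (hdivS l) x))) T a f p)
    {κ : ℝ} (hκ0 : 0 ≤ κ) (hκ1 : κ ≤ 1) (hμ : 0 < C - 2 * d * cmax ^ 2 * κ ^ 2 - amax * (Real.exp (2 * d * κ) - 1))
    (hrate : (1 + d / 2) * (Real.log L / R) ≤ κ)
    {Γ θ δ 𝔅 : ℝ} (hΓ : Γ = (L : ℝ) ^ A * Real.exp (Real.log L / R * (4 * d + 1))) (hθ : θ = 1 / (4 * d * Γ))
    (hδ : δ = κ - (1 + d / 2) * (Real.log L / R))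
    (h𝔅 : 𝔅 = (max (Real.sqrt (11 ^ d)) (Cmv d * Real.sqrt (21 ^ d)) / Real.sqrt (θ ^ d) +
            Real.sqrt (Fintype.card Cp) * (θ + 1) ^ 2 * (amax * Γ ^ 2 * Real.sqrt (Γ ^ d)) / (2 * c₀ ^ 2)) *
          (Real.sqrt (Fintype.card Cp) * Real.exp (κ * ((4 * d + 1) + 2 * d)) *
            ((L : ℝ) ^ A * Real.exp (Real.log L / R * (4 * d + 1))) * (L : ℝ) ^ A * Real.sqrt (((L : ℝ) ^ A) ^ d) /
            (C - 2 * d * cmax ^ 2 * κ ^ 2 - amax * (Real.exp (2 * d * κ) - 1))) +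
          Real.sqrt (Fintype.card Cp) * (θ + 1) ^ 2 / (2 * c₀ ^ 2) *
            Real.exp ((κ - (1 + d / 2) * (Real.log L / R)) * ((4 * d + 1) + 2 * d)))
    (k' : K) (u : UT N × Cp → ℝ) (hu : ∀ p, cellOf S hS hdivS lvl zc hcover p.1 ≠ k' → u p = 0)
    {m : ℝ} (hm : 0 ≤ m) (hum : ∀ p, |u p| ≤ m) (f : UT N × Cp → ℝ)
    (hf : f = (Ring.inverse (levelOp bsrc btgt c Rm (fun l x => ctrU N (S l) (tblk (hS l) (hdivS l) x))
        (fun l x => ω l (ctrU N (S l) (tblk (hS l) (hdivS l) x))) T a)) u)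
    (x : UT N) (μ : Fin d)
    (hnx : (siteScale S hS hdivS lvl zc hcover x : ℝ) ≤ 16 * d * Γ) :
    Real.sqrt (∑ i, covD bsrc btgt c Rm f ((x, μ), i) ^ 2) ≤
      |c₀| * Real.sqrt (Fintype.card Cp) * (𝔅 * (Γ ^ 2 * Real.exp δ + 1) * (16 * d * Γ)) *
        (siteScale S hS hdivS lvl zc hcover x : ℝ) *
        Real.exp (-(δ * sdist bsrc btgt (siteScale S hS hdivS lvl zc hcover) x (ctrU N (S (lvl k')) (zc k')))) * m := by
  classical
  -- abbreviations
  set Aop := levelOp bsrc btgt c Rm (fun l x => ctrU N (S l) (tblk (hS l) (hdivS l) x))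
    (fun l x => ω l (ctrU N (S l) (tblk (hS l) (hdivS l) x))) T a with hAop
  set Pop := levelSum (fun l x => ctrU N (S l) (tblk (hS l) (hdivS l) x))
    (fun l x => ω l (ctrU N (S l) (tblk (hS l) (hdivS l) x))) T a with hPop
  set n := siteScale S hS hdivS lvl zc hcover with hn
  set tk' : UT N := ctrU N (S (lvl k')) (zc k') with htk'
  set D : ℝ := sdist bsrc btgt n x tk' with hD
  generalize hKc : Real.sqrt (Fintype.card Cp) = Kc
  obtain ⟨i₀⟩ := ‹Nonempty Cp›
  -- positivity
  have hd1 : (1 : ℝ) ≤ d := by exact_mod_cast Nat.one_le_iff_ne_zero.mpr (NeZero.ne d)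
  have hd0 : (0 : ℝ) < d := by linarith
  have hL1 : (1 : ℝ) ≤ L := by exact_mod_cast hL
  have ht0 : 0 ≤ Real.log L / R := div_nonneg (Real.log_nonneg hL1) hR.le
  have hΓ1 : 1 ≤ Γ := by
    rw [hΓ]
    exact one_le_mul_of_one_le_of_one_le (one_le_pow₀ hL1) (Real.one_le_exp (mul_nonneg ht0 (by positivity)))
  have hΓ0 : 0 < Γ := by linarith
  have hθ0 : 0 < θ := by rw [hθ]; positivity
  have hδ0 : 0 ≤ δ := by rw [hδ]; linarith
  have hc2 : (0 : ℝ) < c₀ ^ 2 := by positivity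
  have hKc0 : 0 ≤ Kc := by rw [← hKc]; exact Real.sqrt_nonneg _
  have h𝔅0 : 0 ≤ 𝔅 := by rw [h𝔅]; positivity
  have hnpos : ∀ y, (0 : ℝ) < (n y : ℝ) := fun y => by exact_mod_cast one_le_siteScale S hS hdivS lvl zc hcover y
  -- THE CLOSED SUP MEMBER (file 17) at every site-component
  have hsup : ∀ q : UT N × Cp, |f q| ≤ 𝔅 * (n q.1 : ℝ) ^ 2 * Real.exp (-(δ * sdist bsrc btgt n q.1 tk')) * m := by
    intro q
    have h := real_sup_levelOp_inverse_le S hS hdivS lvl zc hdisj hcover Rm hRm T hT a ha ω hsupp hamax hscale c hcc hc₀ hL e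
      hSe hR hadd hc hcoer hκ0 hκ1 hμ hrate hΓ hθ k' u hu hm hum q
    rw [← h𝔅, ← hδ, ← hf] at h
    exact h
  -- (α) on the `d_n`-ball of radius 1 around `x`
  set M := 𝔅 * Γ ^ 2 * Real.exp δ * (n x : ℝ) ^ 2 * Real.exp (-(δ * D)) * m with hM
  have hM0 : 0 ≤ M := by rw [hM]; positivity
  have hαF : ∀ y : UT N, sdist bsrc btgt n y x ≤ 1 → Real.sqrt (∑ j, f (y, j) ^ 2) ≤ Kc * M := fun y hy => by
    rw [← hKc]
    exact norm_le_sqrt_card_of_abs_le (fun j => f (y, j)) hM0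
      (fun j => abs_le_on_unit_ball S hS hdivS lvl zc hcover hL e hSe hR hadd hΓ hδ0 h𝔅0 hm f tk' hsup hy j)
  set E := (n x : ℝ) * Real.exp (-(δ * D)) * m with hE
  have hE0 : 0 ≤ E := by rw [hE]; positivity
  have hup_x : sdist bsrc btgt n (up x μ) x ≤ 1 := by
    have h := abs_sdist_tgt_sub_src_le bsrc btgt n (x, μ) x
    rw [bsrc_apply, btgt_apply, sdist_self] at h
    have h1 := (abs_sub_le_iff.mp h).1
    have h2 := slen_le_one n (one_le_siteScale S hS hdivS lvl zc hcover) x (up x μ)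
    linarith
  have h1 := hαF (up x μ) hup_x
  have h2 : Real.sqrt (∑ j, f (x, j) ^ 2) ≤ Kc * (𝔅 * (n x : ℝ) ^ 2 * Real.exp (-(δ * D)) * m) := by
    rw [← hKc]
    exact norm_le_sqrt_card_of_abs_le (fun j => f (x, j)) (by positivity) (fun j => hsup (x, j))
  have hnx0 : (0 : ℝ) ≤ n x := (hnpos x).le
  have htriv := norm_covD_le_trivial c Rm hRm f (x, μ)
  rw [btgt_apply, bsrc_apply, hcc] at htriv
  calc Real.sqrt (∑ i, covD bsrc btgt c Rm f ((x, μ), i) ^ 2)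
      ≤ |c₀| * (Real.sqrt (∑ j, f (up x μ, j) ^ 2) + Real.sqrt (∑ i, f (x, i) ^ 2)) := htriv
    _ ≤ |c₀| * (Kc * M + Kc * (𝔅 * (n x : ℝ) ^ 2 * Real.exp (-(δ * D)) * m)) :=
        mul_le_mul_of_nonneg_left (add_le_add h1 h2) (abs_nonneg _)
    _ = |c₀| * Kc * (𝔅 * (Γ ^ 2 * Real.exp δ + 1) * (n x : ℝ)) * E := by rw [hM, hE]; ring
    _ ≤ |c₀| * Kc * (𝔅 * (Γ ^ 2 * Real.exp δ + 1) * (16 * d * Γ)) * E :=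
        mul_le_mul_of_nonneg_right (mul_le_mul_of_nonneg_left (mul_le_mul_of_nonneg_left hnx (by positivity)) (by positivity)) hE0
    _ = _ := by rw [hE]; ring

end Main

end

end Summit.QuantumFields.BalabanUV.Beta.MultiscaleGradientCovariantCases
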